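import Literature.Computability.AlgebraicComplexity.InterfaceTensors
import Literature.Barriers.MatrixMultiplication.UniversalMethodBarrierProducts
import HarnessLib

/-!
# Multiplying the regions: copies of interface tensors over disjoint chunk ranges multiply
(Vassilevska Williams–Xu–Xu–Zhou 2024, §5.1 and §5.7) — proved

Topic `Literature/Computability/AlgebraicComplexity`.  §5.1 of Vassilevska Williams–Xu–Xu–Zhou
(SODA 2024, arXiv:2307.07970) divides `(CW_q^{⊗2^{ℓ-1}})^{⊗n}` into three regions
`(CW_q^{⊗2^{ℓ-1}})^{⊗A_r n}` treated independently, and §5.7 multiplies the outcomes: "Overall we get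
`2^{(A₁E₁+A₂E₂+A₃E₃)·n+o(n)}` independent copies of level-`ℓ` `ε`-interface tensors with parameter list
[the concatenation of the three regional lists]".  The algebra behind "overall" is PROVED here:

* `tensorRestrictsTo_copies_mul` — **if `t^{⊗n₁} ≥ ⟨k₁⟩ ⊗ 𝒯_{τ₁,L₁,ε}` and `t^{⊗n₂} ≥ ⟨k₂⟩ ⊗ 𝒯_{τ₂,L₂,ε}`
  then `t^{⊗(n₁+n₂)} ≥ ⟨k₁k₂⟩ ⊗ 𝒯_{τ₁ ⧺ τ₂, L₁ ⧺ L₂, ε}`** (the interface tensor with the concatenated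
  parameter list, `tensorRestrictsTo_kronecker_interfaceTensor_concat`), for the chunked power
  `t = CW_q^{⊗c}` — apply twice for the three regions.

The two relabelling steps — splitting the power `t^{⊗(n₁+n₂)} ≥ t^{⊗n₁} ⊗ t^{⊗n₂}` and the middle-four
interchange `(A ⊗ B) ⊗ (C ⊗ D) ≥ (A ⊗ C) ⊗ (B ⊗ D)` — are the tree's
`Literature.Barriers.MatrixMultiplication.tensorRestrictsTo_kroneckerPow_add` and
`Literature.Barriers.MatrixMultiplication.tensorRestrictsTo_kronecker_interchange`
(`UniversalMethodBarrierProducts.lean`); they are used directly, not restated.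

Everything is proved; no definitions; no named facts.

## References

* V. Vassilevska Williams, Y. Xu, Z. Xu, R. Zhou, *New bounds for matrix multiplication: from alpha
  to omega*, SODA 2024, arXiv:2307.07970 (held: `paper:arxiv-2307.07970`), §5.1 (three regions) and
  §5.7 (Summary: "Overall we get … independent copies … with parameter list …"). [VassilevskaWilliamsXuXuZhou2024]
-/

noncomputable section

open scoped BigOperators
open Finset

namespace Literature.Computability.AlgebraicComplexity

open Literature.Barriers.MatrixMultiplication (bigCwTensor tensorRestrictsTo_unitTensor_mul
  tensorRestrictsTo_kroneckerPow_add tensorRestrictsTo_kronecker_interchange)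

universe u

variable (K : Type u) [CommSemiring K]

variable (q : ℕ) {c n₁ n₂ s₁ s₂ : ℕ}

/-- **Copies of interface tensors over two regions multiply** (§5.7 "Overall"): from
`(CW_q^{⊗c})^{⊗n₁} ≥ ⟨k₁⟩ ⊗ 𝒯_{τ₁,L₁,ε}` and `(CW_q^{⊗c})^{⊗n₂} ≥ ⟨k₂⟩ ⊗ 𝒯_{τ₂,L₂,ε}` one gets
`(CW_q^{⊗c})^{⊗(n₁+n₂)} ≥ ⟨k₁k₂⟩ ⊗ 𝒯_{τ₁⧺τ₂, L₁⧺L₂, ε}`, the copies of the interface tensor with the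
concatenated parameter list. [cite: VassilevskaWilliamsXuXuZhou2024, §5.7 (Summary) and Remark after Def. 3.6] -/
theorem tensorRestrictsTo_copies_mul (τ₁ : Fin n₁ → Fin s₁) (L₁ : Fin s₁ → InterfaceTerm c)
    (τ₂ : Fin n₂ → Fin s₂) (L₂ : Fin s₂ → InterfaceTerm c) (ε : ℝ) {k₁ k₂ : ℕ}
    (h₁ : TensorRestrictsTo (kroneckerPow (kroneckerPow (bigCwTensor K q) c) n₁)
      (kroneckerTensor (unitTensor K k₁) (interfaceTensor K q τ₁ L₁ ε)))
    (h₂ : TensorRestrictsTo (kroneckerPow (kroneckerPow (bigCwTensor K q) c) n₂)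
      (kroneckerTensor (unitTensor K k₂) (interfaceTensor K q τ₂ L₂ ε))) :
    TensorRestrictsTo (kroneckerPow (kroneckerPow (bigCwTensor K q) c) (n₁ + n₂))
      (kroneckerTensor (unitTensor K (k₁ * k₂))
        (interfaceTensor K q (concatTermMap τ₁ τ₂) (Fin.append L₁ L₂) ε)) := by
  refine (tensorRestrictsTo_kroneckerPow_add _ n₁ n₂).trans ?_
  refine (TensorRestrictsTo.kronecker h₁ h₂).trans ?_
  refine (tensorRestrictsTo_kronecker_interchange _ _ _ _).trans ?_
  exact TensorRestrictsTo.kronecker (tensorRestrictsTo_unitTensor_mul (K := K) k₁ k₂)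
    (tensorRestrictsTo_kronecker_interfaceTensor_concat K q τ₁ τ₂ L₁ L₂ ε)

end Literature.Computability.AlgebraicComplexity
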